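/-
Copyright (c) 2026. All rights reserved.
Released under Apache 2.0 license as described in the file LICENSE.
Authors: HodgeCM publication cell (pub-hodgecm), GR lane, seat GR-2 (`pub-hodgecm-own-hyp34`).
-/
import Literature.NumberTheory.Weil1964.AdelicMetaplecticGenerated
import Literature.RepresentationTheory.Unitary.ScaledIsometryExtension
import HarnessLib

/-!
# The UNITARY leg of `Mp_ψ(W_𝐀)ᶜᵒⁿᵗ` on a Hilbert completion of `𝒮(𝐀_F^ι)`

Topic `NumberTheory/Weil1964`; namespace `Literature.NumberTheory.Weil1964`.  KERNEL ONLY: definitions with bodies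
(`adelicMpCont.toOp`, `isometryToLinearEquivHom`, `adelicMpCont.unitaryLegProd`, `adelicMpCont.unitaryLeg`) and proved theorems; no named fact, nothing of [Weil1964] or
[GelbartRogawski1991] asserted.

[GelbartRogawski1991, §3.1 p. 454 L21–27] define `Mp_𝐀(W)` as the pairs `(g, M_g)`, `M_g` a (unitary) operator on the
HILBERT space of `ρ_ψ` with `M_g ρ_ψ(h) M_g⁻¹ = ρ_ψ(g(h))`; the tree's group of record `adelicMpCont F ι T`
(`AdelicMetaplecticContinuous`) consists of the pairs `(g, M)` with `M` an LF-continuous automorphism of the SMOOTH model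
`𝒮(𝐀_F^ι)` [Weil1964, Chap. I n° 11–13].  Passing from the second to the first is "divide `M` by the constant by which
it multiplies the `L²` norm, extend by density" (`RepresentationTheory/Unitary/ScaledIsometryExtension`).  This file
performs that passage for an ABSTRACT completion — a complete normed `ℂ`-space `H` with a dense linear map
`i : 𝒮(𝐀_F^ι) →ₗ[ℂ] H` and a representation `ρ_H` of `H(W_𝐀)` on `H` by continuous operators extending Weil's
`adelicSchrodinger` along `i` (the `L²(𝐀_Fⁿ)` model is the instance of record, supplied elsewhere):

* §1 `adelicMpCont.toOp` — `(g, M) ↦ M` as a homomorphism into `𝒮(𝐀_F^ι) ≃ₗ[ℂ] 𝒮(𝐀_F^ι)`; scalars go to scalars.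
* §2 **`adelicMpCont.toOp_mem_scaledIsometries_of_generators`** — if the Levi operators `Φ ↦ Φ ∘ a⁻¹`, the chirps
  `Φ ↦ ψ(-½ ᵗu c u) Φ` and the Fourier operator of ONE self-dual Haar measure multiply `‖i ·‖` by constants, then so does
  EVERY operator of `Mp_ψ(W_𝐀)ᶜᵒⁿᵗ` (structure theorem `adelicMpCont.eq_top_of_generators_mem`; the scalars `c • id` do so
  trivially) — the smooth Schur lemma is not needed.
* §3 **`adelicMpCont.unitaryLeg i hd hall ρH hρc hρi : adelicMpCont F ι T →* MpPsi ρH`** — `(g, M) ↦ (g, U_M)`, `U_M` the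
  unitary extension of `(scale M)⁻¹ • M`; it lies over the identity of `Sp(W_𝐀)` (`proj_unitaryLeg`), its operators are
  surjective isometries with continuous inverse (`norm_toOp_unitaryLeg`, `continuous_toOp_unitaryLeg(_symm)`), extend
  `(scale M)⁻¹ • M` (`toOp_unitaryLeg_apply_apply`), and the scalars `(1, c • id)` go to the UNIT scalars
  `(1, (c/‖c‖) • id)` (`toOp_unitaryLeg_ofScalar`) — so the leg kills exactly the positive reals of the kernel `ℂˣ`
  (`AdelicMetaplecticKernel`) and is compatible with print's `0 → ℂ* → Mp_𝐀(W) → Sp_𝐀(W) → 0` read with `|c| = 1` on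
  unitary implementers.
* §4 **strong continuity along a map** `continuous_toOp_unitaryLeg_comp_apply`: for `t : Z → Mp_ψ(W_𝐀)ᶜᵒⁿᵗ` with
  `z ↦ i (M_{t z} Φ)` continuous in `H` for every `Φ`, every `z ↦ U_{t z} f` (`f ∈ H`) is continuous — the input of the
  printed "continuous section" clause along a section `t` [GelbartRogawski1991, Prop. 3.1.1 p. 455 L1–2].

## References
* [Weil1964] A. Weil, Acta Math. 111 (1964) 143–211, Chap. I n° 11–13 pp. 157–160, Chap. III n° 34–37.
* [GelbartRogawski1991] S. Gelbart, J. Rogawski, Invent. Math. 105 (1991) 445–472, §3.1 p. 454 L21–27, Prop. 3.1.1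
  p. 455 L1–2.
* [MoeglinVignerasWaldspurger1987] C. Mœglin, M.-F. Vignéras, J.-L. Waldspurger, LNM 1291 (1987), Chap. 2 II.1 (A)–(B).
-/

set_option autoImplicit false

noncomputable section

open NumberField MeasureTheory
open scoped Matrix

namespace Literature.NumberTheory.Weil1964

open Literature.RepresentationTheory.HeisenbergGroup Literature.NumberTheory.Automorphic
open Literature.RepresentationTheory.Unitary

variable (F : Type) [Field F] [NumberField F] (ι : Type) [Fintype ι] [DecidableEq ι]
variable (T : Matrix ι ι (AdeleRing (𝓞 F) F))

/-! ## §1 The operator homomorphism of the group of record -/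

/-- **`(g, M) ↦ M`** on `Mp_ψ(W_𝐀)ᶜᵒⁿᵗ`, as a homomorphism into the linear automorphisms of `𝒮(𝐀_F^ι)` (`MpPsi.toOp`
restricted to the group of record). [cite: GelbartRogawski1991, §3.1 p. 454 L24–25] -/
def adelicMpCont.toOp : adelicMpCont F ι T →* (piSchwartzBruhat F ι ≃ₗ[ℂ] piSchwartzBruhat F ι) :=
  (MpPsi.toOp (adelicSchrodinger F ι T)).comp (adelicMpCont F ι T).subtype

variable {F ι T}

/-- `toOp p` is the operator component of the underlying pair. [cite: GelbartRogawski1991, §3.1 p. 454 L24–25] -/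
@[simp] theorem adelicMpCont.toOp_apply (p : adelicMpCont F ι T) :
    adelicMpCont.toOp F ι T p = MpPsi.toOp (adelicSchrodinger F ι T) (p : adelicMp F ι T) := rfl

/-- `toOp p Φ = ω(p) Φ`. [cite: GelbartRogawski1991, §3.1 p. 454 L24–25] -/
theorem adelicMpCont.toOp_apply_apply (p : adelicMpCont F ι T) (Φ : piSchwartzBruhat F ι) :
    adelicMpCont.toOp F ι T p Φ = adelicMpCont.omega F ι T p Φ := rfl

/-- **the smooth relation (A)**: `M ρ(h) = ρ(g h) M` on `𝒮(𝐀_F^ι)` for `(g, M) ∈ Mp_ψ(W_𝐀)ᶜᵒⁿᵗ`.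
[cite: MoeglinVignerasWaldspurger1987, Chap. 2 II.1 (A); GelbartRogawski1991, §3.1 p. 454 L21–24] -/
theorem adelicMpCont.toOp_apply_adelicSchrodinger (p : adelicMpCont F ι T) (h : AdelicHeisenberg F ι T)
    (Φ : piSchwartzBruhat F ι) :
    adelicMpCont.toOp F ι T p (adelicSchrodinger F ι T h Φ) =
      adelicSchrodinger F ι T ((ofSymplectic _ (adelicMpCont.proj F ι T p)).act h) (adelicMpCont.toOp F ι T p Φ) :=
  (mem_MpPsi (adelicSchrodinger F ι T) _).1 (p : adelicMp F ι T).2 h Φ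

/-- the scalars go to the scalars: `toOp (1, c • id) = c • id`. [cite: MoeglinVignerasWaldspurger1987, Chap. 2 II.1 (B)] -/
theorem adelicMpCont.toOp_ofScalar (c : ℂˣ) :
    adelicMpCont.toOp F ι T (adelicMpCont.ofScalar F ι T c) = DistribMulAction.toLinearEquiv ℂ (piSchwartzBruhat F ι) c :=
  rfl

/-! ### Glue: forgetting the isometry property -/

section Glue

variable {H : Type*} [NormedAddCommGroup H] [NormedSpace ℂ H]

/-- `e ↦ e.toLinearEquiv`, forgetting the isometry property, as a monoid homomorphism
`(H ≃ₗᵢ[ℂ] H) →* (H ≃ₗ[ℂ] H)` (Mathlib glue; both group laws are composition). [folklore] -/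
def isometryToLinearEquivHom (H : Type*) [NormedAddCommGroup H] [NormedSpace ℂ H] : (H ≃ₗᵢ[ℂ] H) →* (H ≃ₗ[ℂ] H) where
  toFun e := e.toLinearEquiv
  map_one' := rfl
  map_mul' _ _ := rfl

end Glue

/-! ## §2 Scaled isometries: it suffices to check the generators -/

section Generators

variable {H : Type*} [NormedAddCommGroup H] [NormedSpace ℂ H]
variable {n : ℕ} (T : Matrix (Fin n) (Fin n) (AdeleRing (𝓞 F) F)) (hT : IsUnit T.det)
variable [MeasurableSpace (AdeleRing (𝓞 F) F)] [BorelSpace (AdeleRing (𝓞 F) F)]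
  (ν : Measure (Fin n → AdeleRing (𝓞 F) F)) [ν.IsAddHaarMeasure] (hν : ν (piFundamentalDomain F (Fin n)) = 1)

include hT hν in
/-- **every operator of `Mp_ψ(W_𝐀)ᶜᵒⁿᵗ` multiplies `‖i ·‖` by a constant as soon as the generators do**: if the Levi operators
`Φ ↦ Φ ∘ a⁻¹` (`a ∈ GL_n(𝐀_F)`), the chirps `Φ ↦ ψ(-½ ᵗu c u) Φ` (`c ∈ Sym_n(𝐀_F)`) and the Fourier operator of one
self-dual Haar measure are scaled `i`-isometries, then so is `toOp p` for EVERY `p` — `Mp_ψ(W_𝐀)ᶜᵒⁿᵗ` is generated by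
these and the scalars (`adelicMpCont.eq_top_of_generators_mem`), the scaled isometries form a subgroup, and `c • id`
scales by `‖c‖`. [cite: Weil1964, Chap. I n° 13 p. 160; MoeglinVignerasWaldspurger1987, Chap. 2 II.6] -/
theorem adelicMpCont.toOp_mem_scaledIsometries_of_generators (i : piSchwartzBruhat F (Fin n) →ₗ[ℂ] H)
    (hm : ∀ a : GL (Fin n) (AdeleRing (𝓞 F) F),
      MpPsi.toOp (adelicSchrodinger F (Fin n) T) (leviPair F T hT a) ∈ scaledIsometries i)
    (hv : ∀ (c : Matrix (Fin n) (Fin n) (AdeleRing (𝓞 F) F)) (hc : c.IsSymm),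
      MpPsi.toOp (adelicSchrodinger F (Fin n) T) (unipPair F T hT c hc) ∈ scaledIsometries i)
    (hJ : MpPsi.toOp (adelicSchrodinger F (Fin n) T) (weylPair F T hT ν hν) ∈ scaledIsometries i)
    (p : adelicMpCont F (Fin n) T) : adelicMpCont.toOp F (Fin n) T p ∈ scaledIsometries i := by
  have h := adelicMpCont.eq_top_of_generators_mem F T hT ν hν
    (H := (scaledIsometries i).comap (adelicMpCont.toOp F (Fin n) T))
    (fun a => hm a) (fun c hc => hv c hc) hJ (fun c => toLinearEquiv_mem_scaledIsometries i c)
  have hp : p ∈ (scaledIsometries i).comap (adelicMpCont.toOp F (Fin n) T) := by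
    rw [h]
    exact Subgroup.mem_top p
  exact hp

include hT hν in
/-- the same with EXACT isometries on the chirps and the Fourier operator and a constant on the Levi operators (the
shape of the facts: `|ψ| = 1`, Plancherel for the self-dual measure, Haar measure scaling under `GL_n(𝐀_F)`).
[cite: Weil1964, Chap. I n° 13 p. 160; MoeglinVignerasWaldspurger1987, Chap. 2 II.6] -/
theorem adelicMpCont.toOp_mem_scaledIsometries_of_generators' (i : piSchwartzBruhat F (Fin n) →ₗ[ℂ] H)
    (hm : ∀ a : GL (Fin n) (AdeleRing (𝓞 F) F), ∃ r : ℝ, 0 < r ∧ ∀ Φ : piSchwartzBruhat F (Fin n),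
      ‖i (MpPsi.toOp (adelicSchrodinger F (Fin n) T) (leviPair F T hT a) Φ)‖ = r * ‖i Φ‖)
    (hv : ∀ (c : Matrix (Fin n) (Fin n) (AdeleRing (𝓞 F) F)) (hc : c.IsSymm) (Φ : piSchwartzBruhat F (Fin n)),
      ‖i (MpPsi.toOp (adelicSchrodinger F (Fin n) T) (unipPair F T hT c hc) Φ)‖ = ‖i Φ‖)
    (hJ : ∀ Φ : piSchwartzBruhat F (Fin n), ‖i ((fourierEquiv F (Fin n) ν hν).symm Φ)‖ = ‖i Φ‖)
    (p : adelicMpCont F (Fin n) T) : adelicMpCont.toOp F (Fin n) T p ∈ scaledIsometries i :=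
  adelicMpCont.toOp_mem_scaledIsometries_of_generators T hT ν hν i hm
    (fun c hc => mem_scaledIsometries_of_norm_eq i (hv c hc))
    (by rw [toOp_weylPair]; exact mem_scaledIsometries_of_norm_eq i hJ) p

end Generators

/-! ## §3 The unitary leg -/

section Leg

variable {H : Type*} [NormedAddCommGroup H] [NormedSpace ℂ H] [CompleteSpace H]
variable (i : piSchwartzBruhat F ι →ₗ[ℂ] H) (hd : DenseRange i)
  (hall : ∀ p : adelicMpCont F ι T, adelicMpCont.toOp F ι T p ∈ scaledIsometries i)
  (ρH : Representation ℂ (AdelicHeisenberg F ι T) H) (hρc : ∀ h, Continuous (ρH h))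
  (hρi : ∀ (h : AdelicHeisenberg F ι T) (Φ : piSchwartzBruhat F ι), ρH h (i Φ) = i (adelicSchrodinger F ι T h Φ))

include hρc hρi in
/-- **the printed relation for the unitary extension**: for `(g, M) ∈ Mp_ψ(W_𝐀)ᶜᵒⁿᵗ` the pair `(g, U_M)`, `U_M` the unitary
extension to `H` of `(scale M)⁻¹ • M`, satisfies `U_M ρ_H(h) = ρ_H(g h) U_M` — both sides are continuous and agree on
the dense `i(𝒮(𝐀_F^ι))` by the smooth relation (A). [cite: GelbartRogawski1991, §3.1 p. 454 L21–24;
MoeglinVignerasWaldspurger1987, Chap. 2 II.1 (A)] -/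
theorem adelicMpCont.unitaryRep_toOp_mem_MpPsi (p : adelicMpCont F ι T) :
    ((adelicMpCont.proj F ι T p,
        (unitaryRep i hd (adelicMpCont.toOp F ι T) hall p).toLinearEquiv) :
      symplecticGroup (polar (adelicForm F ι T)) × (H ≃ₗ[ℂ] H)) ∈ MpPsi ρH := by
  rw [mem_MpPsi]
  intro h f
  exact unitaryRep_apply_eq_of_semiconj i hd (adelicMpCont.toOp F ι T) hall p (hρc h) (hρc _)
    (fun Φ => hρi h Φ) (fun Φ => hρi _ Φ) (fun Φ => adelicMpCont.toOp_apply_adelicSchrodinger p h Φ) f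

/-- the leg with values in the ambient product `Sp(W_𝐀) × GL(H)`: `(g, M) ↦ (g, U_M)` (`MonoidHom.prod`; no relation yet).
[cite: GelbartRogawski1991, §3.1 p. 454 L21–25] -/
def adelicMpCont.unitaryLegProd :
    adelicMpCont F ι T →* symplecticGroup (polar (adelicForm F ι T)) × (H ≃ₗ[ℂ] H) :=
  (adelicMpCont.proj F ι T).prod ((isometryToLinearEquivHom H).comp (unitaryRep i hd (adelicMpCont.toOp F ι T) hall))

/-- the value of `unitaryLegProd`. [cite: GelbartRogawski1991, §3.1 p. 454 L21–25] -/
theorem adelicMpCont.unitaryLegProd_apply (p : adelicMpCont F ι T) :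
    adelicMpCont.unitaryLegProd i hd hall p =
      (adelicMpCont.proj F ι T p, (unitaryRep i hd (adelicMpCont.toOp F ι T) hall p).toLinearEquiv) := rfl

include hρc hρi in
/-- every value of `unitaryLegProd` satisfies the printed relation (A) for `ρ_H`. [cite: GelbartRogawski1991, §3.1 p. 454
L21–24; MoeglinVignerasWaldspurger1987, Chap. 2 II.1 (A)] -/
theorem adelicMpCont.unitaryLegProd_mem_MpPsi (p : adelicMpCont F ι T) :
    adelicMpCont.unitaryLegProd i hd hall p ∈ MpPsi ρH :=
  adelicMpCont.unitaryRep_toOp_mem_MpPsi i hd hall ρH hρc hρi p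

/-- **THE UNITARY LEG `Mp_ψ(W_𝐀)ᶜᵒⁿᵗ →* MpPsi ρ_H`**, `(g, M) ↦ (g, U_M)`: the smooth metaplectic group of record mapped,
over the identity of `Sp(W_𝐀)`, into the group of pairs of the Hilbert-space model `ρ_H` ⊇ `i ∘ ρ_ψ` — print's `Mp_𝐀(W)` when
`H = L²`. Hypotheses: `i` dense, every `M` a scaled `i`-isometry (`toOp_mem_scaledIsometries_of_generators`), `ρ_H(h)`
continuous and extending `adelicSchrodinger h` along `i`. [cite: GelbartRogawski1991, §3.1 p. 454 L21–27; Weil1964,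
Chap. I n° 13 p. 160] -/
def adelicMpCont.unitaryLeg : adelicMpCont F ι T →* MpPsi ρH :=
  (adelicMpCont.unitaryLegProd i hd hall).codRestrict (MpPsi ρH)
    (adelicMpCont.unitaryLegProd_mem_MpPsi i hd hall ρH hρc hρi)

/-- the underlying pair of `unitaryLeg p` is `(π p, U_M)`. [cite: GelbartRogawski1991, §3.1 p. 454 L21–25] -/
theorem adelicMpCont.coe_unitaryLeg (p : adelicMpCont F ι T) :
    ((adelicMpCont.unitaryLeg i hd hall ρH hρc hρi p : MpPsi ρH) :
        symplecticGroup (polar (adelicForm F ι T)) × (H ≃ₗ[ℂ] H)) =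
      (adelicMpCont.proj F ι T p, (unitaryRep i hd (adelicMpCont.toOp F ι T) hall p).toLinearEquiv) := rfl

/-- **the leg lies over the identity of `Sp(W_𝐀)`**: `π(unitaryLeg p) = π(p)`. [cite: GelbartRogawski1991, §3.1 p. 454 L25] -/
@[simp] theorem adelicMpCont.proj_unitaryLeg (p : adelicMpCont F ι T) :
    MpPsi.proj ρH (adelicMpCont.unitaryLeg i hd hall ρH hρc hρi p) = adelicMpCont.proj F ι T p := rfl

/-- the operator of the leg is the unitary extension `U_M`. [cite: GelbartRogawski1991, §3.1 p. 454 L24–25] -/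
theorem adelicMpCont.toOp_unitaryLeg_apply (p : adelicMpCont F ι T) (f : H) :
    MpPsi.toOp ρH (adelicMpCont.unitaryLeg i hd hall ρH hρc hρi p) f =
      unitaryRep i hd (adelicMpCont.toOp F ι T) hall p f := rfl

/-- **`U_M (i Φ) = (scale M)⁻¹ • i (M Φ)`**: the leg extends the normalised smooth operators.
[cite: Weil1964, Chap. I n° 13 p. 160; GelbartRogawski1991, §3.1 p. 454 L21–24] -/
theorem adelicMpCont.toOp_unitaryLeg_apply_apply (p : adelicMpCont F ι T) (Φ : piSchwartzBruhat F ι) :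
    MpPsi.toOp ρH (adelicMpCont.unitaryLeg i hd hall ρH hρc hρi p) (i Φ) =
      ((scale i (adelicMpCont.toOp F ι T p) : ℂ)⁻¹) • i (adelicMpCont.toOp F ι T p Φ) :=
  unitaryRep_apply_apply i hd (adelicMpCont.toOp F ι T) hall p Φ

/-- when `M` is an EXACT `i`-isometry the leg extends `M` itself: `U_M (i Φ) = i (M Φ)`.
[cite: Weil1964, Chap. I n° 13 p. 160] -/
theorem adelicMpCont.toOp_unitaryLeg_apply_apply_of_norm_eq (p : adelicMpCont F ι T)
    (hp : ∀ Φ, ‖i (adelicMpCont.toOp F ι T p Φ)‖ = ‖i Φ‖) (Φ : piSchwartzBruhat F ι) :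
    MpPsi.toOp ρH (adelicMpCont.unitaryLeg i hd hall ρH hρc hρi p) (i Φ) = i (adelicMpCont.toOp F ι T p Φ) :=
  unitaryExt_apply_of_norm_eq i hd ⟨adelicMpCont.toOp F ι T p, hall p⟩ hp Φ

/-- **the operators of the leg are isometries** ("unitary representation … `ω_ψ`", p. 454 L24–25).
[cite: GelbartRogawski1991, §3.1 p. 454 L24–25] -/
theorem adelicMpCont.norm_toOp_unitaryLeg (p : adelicMpCont F ι T) (f : H) :
    ‖MpPsi.toOp ρH (adelicMpCont.unitaryLeg i hd hall ρH hρc hρi p) f‖ = ‖f‖ :=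
  norm_unitaryRep_apply i hd (adelicMpCont.toOp F ι T) hall p f

/-- the operators of the leg are onto. [cite: GelbartRogawski1991, §3.1 p. 454 L24–25] -/
theorem adelicMpCont.surjective_toOp_unitaryLeg (p : adelicMpCont F ι T) :
    Function.Surjective (MpPsi.toOp ρH (adelicMpCont.unitaryLeg i hd hall ρH hρc hρi p)) :=
  (unitaryRep i hd (adelicMpCont.toOp F ι T) hall p).surjective

/-- the operators of the leg are continuous ("operator" = bounded, rendering R4 of `Prop311AsPrinted`).
[cite: GelbartRogawski1991, §3.1 p. 454 L23] -/
theorem adelicMpCont.continuous_toOp_unitaryLeg (p : adelicMpCont F ι T) :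
    Continuous (MpPsi.toOp ρH (adelicMpCont.unitaryLeg i hd hall ρH hρc hρi p)) :=
  (unitaryRep i hd (adelicMpCont.toOp F ι T) hall p).continuous

/-- … and so are their inverses. [cite: GelbartRogawski1991, §3.1 p. 454 L23] -/
theorem adelicMpCont.continuous_toOp_unitaryLeg_symm (p : adelicMpCont F ι T) :
    Continuous (MpPsi.toOp ρH (adelicMpCont.unitaryLeg i hd hall ρH hρc hρi p)).symm :=
  (unitaryRep i hd (adelicMpCont.toOp F ι T) hall p).symm.continuous

/-- **the scalars go to the UNIT scalars**: `unitaryLeg (1, c • id)` acts on `H` by `(c / ‖c‖) • id` — the leg kills exactly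
the positive reals of `ker π = ℂˣ`. [cite: GelbartRogawski1991, §3.1 p. 454 L26–27; MoeglinVignerasWaldspurger1987,
Chap. 2 II.1 (B)] -/
theorem adelicMpCont.toOp_unitaryLeg_ofScalar (c : ℂˣ) (f : H) :
    MpPsi.toOp ρH (adelicMpCont.unitaryLeg i hd hall ρH hρc hρi (adelicMpCont.ofScalar F ι T c)) f =
      ((‖(c : ℂ)‖ : ℂ)⁻¹ * c) • f := by
  rw [adelicMpCont.toOp_unitaryLeg_apply, unitaryRep_apply]
  exact unitaryExt_toLinearEquiv_smul i hd c f

/-- `π(unitaryLeg (1, c • id)) = 1`. [cite: MoeglinVignerasWaldspurger1987, Chap. 2 II.1 (B)] -/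
theorem adelicMpCont.proj_unitaryLeg_ofScalar (c : ℂˣ) :
    MpPsi.proj ρH (adelicMpCont.unitaryLeg i hd hall ρH hρc hρi (adelicMpCont.ofScalar F ι T c)) = 1 := rfl

/-! ## §4 Strong continuity along a map -/

/-- **strong continuity of the leg along a map** `t : Z → Mp_ψ(W_𝐀)ᶜᵒⁿᵗ`: if `z ↦ i (M_{t z} Φ)` is continuous in `H` for every
`Φ ∈ 𝒮(𝐀_F^ι)`, then `z ↦ U_{M_{t z}} f` is continuous for every `f ∈ H` (the constants `scale M_{t z}` are then continuous in
`z`, and `U` is a uniform limit of its values on `i(𝒮)`).  With `t` a section over `G(𝐀)` this is the operator half of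
print's "continuous section". [cite: GelbartRogawski1991, Prop. 3.1.1 p. 455 L1–2; Weil1964, Chap. I n° 13 p. 160] -/
theorem adelicMpCont.continuous_toOp_unitaryLeg_comp_apply {Z : Type*} [TopologicalSpace Z]
    (t : Z → adelicMpCont F ι T) (ht : ∀ Φ : piSchwartzBruhat F ι, Continuous fun z => i (adelicMpCont.toOp F ι T (t z) Φ))
    (f : H) :
    Continuous fun z => MpPsi.toOp ρH (adelicMpCont.unitaryLeg i hd hall ρH hρc hρi (t z)) f :=
  continuous_unitaryRep_comp_apply i hd (adelicMpCont.toOp F ι T) hall t ht f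

/-- the symplectic half is tautological: `z ↦ π(unitaryLeg (t z)) w = π(t z) w`. [cite: GelbartRogawski1991, Prop. 3.1.1
p. 455 L1–2] -/
theorem adelicMpCont.continuous_proj_unitaryLeg_comp_apply {Z : Type*} [TopologicalSpace Z]
    (t : Z → adelicMpCont F ι T) (w : (ι → AdeleRing (𝓞 F) F) × (ι → AdeleRing (𝓞 F) F))
    (ht : Continuous fun z => ((adelicMpCont.proj F ι T (t z) : symplecticGroup (polar (adelicForm F ι T))) :
      ((ι → AdeleRing (𝓞 F) F) × (ι → AdeleRing (𝓞 F) F)) ≃ₗ[AdeleRing (𝓞 F) F]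
        ((ι → AdeleRing (𝓞 F) F) × (ι → AdeleRing (𝓞 F) F))) w) :
    Continuous fun z => ((MpPsi.proj ρH (adelicMpCont.unitaryLeg i hd hall ρH hρc hρi (t z)) :
      symplecticGroup (polar (adelicForm F ι T))) :
        ((ι → AdeleRing (𝓞 F) F) × (ι → AdeleRing (𝓞 F) F)) ≃ₗ[AdeleRing (𝓞 F) F]
          ((ι → AdeleRing (𝓞 F) F) × (ι → AdeleRing (𝓞 F) F))) w :=
  ht

end Leg

end Literature.NumberTheory.Weil1964

end
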